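/-
Copyright (c) 2026 the pub-hodgecm-mathlib formalisation cell (harness21).  Prover seat hodgecm-mathlib-K2E1-p02 (g5), Track B ∕ K2-LIT,
h413 = `stmt-HodgeConjecture-24833`, line `K2_E1_TraceFormulaBeta`, «EIS-RANK-ONE»: the K2Liu junction at `n = 1`, part 3b — the rank-one INTERTWINING
OPERATOR `M(w₀)` of `U(J₂)` (★ p857354 `intertwiningU`) IS K2Liu's Siegel intertwining integral `M(s)` (★ D9 `intertwiningDelta`) at `n = 1`.  2026-09-04.
-/
import Summits.HodgeConjecture.HodgeConjecture.Theorems.K2E1BorelEisensteinU2FromK2LiuTransport   -- ★ p857306 ∕ p857351 (parts 1–2): `bridge_congr`, `blk_toBlocks_one`, `matrix_fin_one_eq_iff`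
import Summits.HodgeConjecture.HodgeConjecture.Theorems.K2E1EisensteinIntertwiningU             -- ★ p857354 (K2E1-p09 (g4)): `intertwiningU N ν w φ x = ∫_N φ(x v w⁻¹) dν`
import Literature.NumberTheory.K2Lit.SiegelDoubledUnipotent                                       -- ★ D9 (K2Liu): `unipDelta`, `weylDelta`, `intertwiningDelta`, `eq_of_blk_eq`
import HarnessLib

/-!
# h413 ∕ Track B «K2-LIT», «EIS-RANK-ONE» — helper `K2E1BorelIntertwiningU2FromK2Liu` (K2Liu junction at `n = 1`, part 3b):
# `M(w₀)` on `U(J₂)` (★ `intertwiningU`) `=` K2Liu's `M(s)` (★ `intertwiningDelta`) at `n = 1`, along `Ψ_S`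

Cell `pub/hodgecm-mathlib`, crux H413 = `stmt-HodgeConjecture-24833`, route `HCCMUnconditional`; chair K2-lead (g0); DEAL «K2Liu JUNCTION part 3 (3b)» of the dealer
K2E1-plan (g3) 2026-09-04T04:32:24Z ∕ 04:34:51Z («GO NOW»).  THEOREMS ONLY (no `def`, no `instance`, no `notation`, no named-fact hypothesis, no `sorry`); lane
`--kind proof --supports stmt-HodgeConjecture-24833 --as helper` (count-neutral).

THE DICTIONARY, continued (★ part 1: `Ψ_S g = S_𝔸 g S_𝔸⁻¹ : U(Φ) ≅ H = U(𝕍 ⊕ −𝕍)` at `n = 1`, `S = (1 ½; 1 −½)`, Borel `↦ P_Δ`).  NEW HERE: the statements are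
FORM-GENERIC — for every `Φ` congruent to `hermD` through `S` (the hypothesis `hΦ`, discharged by ★ `bridge_congr` for the route's literal `Φ₂` and by
`bridge_congr_over` for the campaign's `(StdForm.antidiagonal 2).over L`), so that K2E1-p09's `adelicUnipotent`∕`quasiSplit` tokens are served directly:
* §1 `conj_entries` — the four entries of `S_𝔸 g S_𝔸⁻¹` (`2 × 2` arithmetic, `k = ½_𝔸`); `mem_unipDelta_one_iff` — `N_Δ(𝔸)` AT `n = 1` IN ENTRIES:
  `h ∈ N_Δ ↔ h₀₀ + h₀₁ = 1 ∧ h₁₀ + h₁₁ = 1 ∧ h₁₁ − h₀₁ = 1`; **`congr_mem_unipDelta_iff`** — `Ψ_S g ∈ N_Δ(𝔸) ↔ g₁₀ = 0 ∧ g₀₀ = 1 ∧ g₁₁ = 1` (the unipotent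
  radical `N` of the Borel of `U(Φ)` is carried ONTO `N_Δ`; `Ψ_S n(x) = ((1+x, −x), (x, 1−x))`, frame `(1 −x; 0 1)`); **`congr_eq_weylDelta`** — the SCALED long
  Weyl element `w = (0 ½; 2 0) ∈ U(Φ)(𝔸)` is carried to K2Liu's `w_Δ = ι(1, −1)` (`Ψ_S w = diag(1, −1)`; the unscaled `w₀ = antidiag(1,1)` goes to `w_Δ · Ψ_S(diag(½, 2))`).
* §2 (transport of integrals, generic) `integral_map_subtype_equiv` — `∫_{N'} F d(ψ⁎ν) = ∫_N F ∘ ψ dν` for a measurable bijection `ψ` carrying `N ≤ G` onto `N' ≤ H`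
  (Mathlib `MeasureTheory.integral_map_equiv`; no integrability needed).
* §3 (`U(J₂)`, campaign tokens) `bridge_congr_over`; `mem_adelicUnipotent_two_iff` (`v ∈ N(𝔸) ↔ v₁₀ = 0 ∧ v₀₀ = v₁₁ = 1`); **`congr_mem_unipDelta_iff_mem_adelicUnipotent`**
  (`Ψ_S v ∈ N_Δ(𝔸) ↔ v ∈ adelicUnipotent`); `exists_scaledWeyl_two` (a rational `w ∈ U(J₂)(L⁺)` with `w_𝔸 ↦ w_Δ`); **`intertwiningU_eq_intertwiningDelta`** — for an
  inversion-invariant measure `ν` on `N(𝔸)`, any `f : H(𝔸) → ℂ` and `w` with `Ψ_S w = w_Δ`: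
  `intertwiningU N(𝔸) ν w (f ∘ Ψ_S ∘ inv) x = intertwiningDelta ((Ψ_S|_N)⁎ν) f (Ψ_S x⁻¹)` — p09's RIGHT-convention `M(w)` of `φ = f ∘ Ψ_S ∘ inv` IS K2Liu's
  LEFT-convention `M(s) f` at the transported point, against the transported Haar measure (`(Ψ_S|_N)⁎ν` is a Haar measure on `N_Δ(𝔸)` since `Ψ_S|_N : N ≅ N_Δ` is a
  topological isomorphism; its normalisation against K2Liu's Tamagawa choice is NOT fixed here).

HONEST LABEL.  Count-neutral helper; proves no printed statement; HC_CM is proved only modulo the 7 printed citations (2 remaining named inputs: hLiu418 =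
`stmt-HodgeConjecture-24832`, h413 = `stmt-HodgeConjecture-24833`) until rung 0 closes.

## References
* [MoeglinWaldspurger1995] C. Mœglin, J.-L. Waldspurger, *Spectral decomposition and Eisenstein series* (1995), II.1.6 (intertwining operators `M(w, π)`).
* [Tan1999] V. Tan, *Poles of Siegel Eisenstein series on U(n,n)*, Canad. J. Math. 51 (1999), §1–§2 (`P = MN`, `M(s)`).
* [GelbartRogawski1991] S. Gelbart, J. Rogawski, *L-functions and Fourier–Jacobi coefficients for the unitary group U(3)*, Invent. Math. 105 (1991), §3.1.
-/

set_option autoImplicit false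
set_option linter.dupNamespace false  -- the mandated namespace repeats the summit's segment (`HodgeConjecture.HodgeConjecture`)

noncomputable section

open scoped Matrix
open MeasureTheory NumberField IsDedekindDomain MulAction
open Literature.NumberTheory.Automorphic Literature.NumberTheory.Automorphic.UnitaryGroup Literature.NumberTheory.GaloisRepresentations
open Literature.NumberTheory.GelbartRogawski1991 Literature.NumberTheory.GelbartRogawski1991.GRConstruction
open Literature.NumberTheory.K2Lit.SiegelDoubled
open Summit.HodgeConjecture.HodgeConjecture.Cruxes.H413.K2E1BorelEisensteinU2FromK2Liu
open Summit.HodgeConjecture.HodgeConjecture.Cruxes.H413.K2E1EisensteinIntertwiningU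

namespace Summit.HodgeConjecture.HodgeConjecture.Cruxes.H413.K2E1BorelIntertwiningU2FromK2Liu

/-! ## §1 `Ψ_S` carries `N` onto `N_Δ` and the scaled long Weyl element to `w_Δ` (form-generic) -/

section Dictionary

variable (L : Type) [Field L] [NumberField L] [IsCMField L]

omit [IsCMField L] in
/-- **The four entries of `S_𝔸 g S_𝔸⁻¹`** for `S = (1 ½; 1 −½)`, `S⁻¹ = (½ ½; 1 −1)`, `g = (a b; c d) ∈ GL₂(𝔸_L)`, `k = ½_𝔸`:
`(ka + k²c + b + kd, ka + k²c − b − kd; ka − k²c + b − kd, ka − k²c − b + kd)`. [folklore] -/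
theorem conj_entries (S : GL (Fin 2) L) (hS : (S : Matrix (Fin 2) (Fin 2) L) = !![1, 2⁻¹; 1, -2⁻¹])
    (hS' : ((S⁻¹ : GL (Fin 2) L) : Matrix (Fin 2) (Fin 2) L) = !![2⁻¹, 2⁻¹; 1, -1]) (g : GL (Fin 2) (AdeleRing (𝓞 L) L)) :
    ((toAdeleGL L S * g * (toAdeleGL L S)⁻¹ : GL (Fin 2) (AdeleRing (𝓞 L) L)) : Matrix (Fin 2) (Fin 2) (AdeleRing (𝓞 L) L)) 0 0 =
        algebraMap L (AdeleRing (𝓞 L) L) 2⁻¹ * (g : Matrix (Fin 2) (Fin 2) (AdeleRing (𝓞 L) L)) 0 0 +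
          algebraMap L (AdeleRing (𝓞 L) L) 2⁻¹ * algebraMap L (AdeleRing (𝓞 L) L) 2⁻¹ * (g : Matrix (Fin 2) (Fin 2) (AdeleRing (𝓞 L) L)) 1 0 +
          (g : Matrix (Fin 2) (Fin 2) (AdeleRing (𝓞 L) L)) 0 1 + algebraMap L (AdeleRing (𝓞 L) L) 2⁻¹ * (g : Matrix (Fin 2) (Fin 2) (AdeleRing (𝓞 L) L)) 1 1 ∧
      ((toAdeleGL L S * g * (toAdeleGL L S)⁻¹ : GL (Fin 2) (AdeleRing (𝓞 L) L)) : Matrix (Fin 2) (Fin 2) (AdeleRing (𝓞 L) L)) 0 1 =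
        algebraMap L (AdeleRing (𝓞 L) L) 2⁻¹ * (g : Matrix (Fin 2) (Fin 2) (AdeleRing (𝓞 L) L)) 0 0 +
          algebraMap L (AdeleRing (𝓞 L) L) 2⁻¹ * algebraMap L (AdeleRing (𝓞 L) L) 2⁻¹ * (g : Matrix (Fin 2) (Fin 2) (AdeleRing (𝓞 L) L)) 1 0 -
          (g : Matrix (Fin 2) (Fin 2) (AdeleRing (𝓞 L) L)) 0 1 - algebraMap L (AdeleRing (𝓞 L) L) 2⁻¹ * (g : Matrix (Fin 2) (Fin 2) (AdeleRing (𝓞 L) L)) 1 1 ∧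
      ((toAdeleGL L S * g * (toAdeleGL L S)⁻¹ : GL (Fin 2) (AdeleRing (𝓞 L) L)) : Matrix (Fin 2) (Fin 2) (AdeleRing (𝓞 L) L)) 1 0 =
        algebraMap L (AdeleRing (𝓞 L) L) 2⁻¹ * (g : Matrix (Fin 2) (Fin 2) (AdeleRing (𝓞 L) L)) 0 0 -
          algebraMap L (AdeleRing (𝓞 L) L) 2⁻¹ * algebraMap L (AdeleRing (𝓞 L) L) 2⁻¹ * (g : Matrix (Fin 2) (Fin 2) (AdeleRing (𝓞 L) L)) 1 0 +
          (g : Matrix (Fin 2) (Fin 2) (AdeleRing (𝓞 L) L)) 0 1 - algebraMap L (AdeleRing (𝓞 L) L) 2⁻¹ * (g : Matrix (Fin 2) (Fin 2) (AdeleRing (𝓞 L) L)) 1 1 ∧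
      ((toAdeleGL L S * g * (toAdeleGL L S)⁻¹ : GL (Fin 2) (AdeleRing (𝓞 L) L)) : Matrix (Fin 2) (Fin 2) (AdeleRing (𝓞 L) L)) 1 1 =
        algebraMap L (AdeleRing (𝓞 L) L) 2⁻¹ * (g : Matrix (Fin 2) (Fin 2) (AdeleRing (𝓞 L) L)) 0 0 -
          algebraMap L (AdeleRing (𝓞 L) L) 2⁻¹ * algebraMap L (AdeleRing (𝓞 L) L) 2⁻¹ * (g : Matrix (Fin 2) (Fin 2) (AdeleRing (𝓞 L) L)) 1 0 -
          (g : Matrix (Fin 2) (Fin 2) (AdeleRing (𝓞 L) L)) 0 1 + algebraMap L (AdeleRing (𝓞 L) L) 2⁻¹ * (g : Matrix (Fin 2) (Fin 2) (AdeleRing (𝓞 L) L)) 1 1 := by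
  rw [← map_inv (toAdeleGL L) S]
  simp only [Units.val_mul, val_toAdeleGL, hS, hS', Matrix.mul_apply, Fin.sum_univ_two, Matrix.map_apply, Matrix.of_apply, Matrix.cons_val',
    Matrix.cons_val_zero, Matrix.cons_val_one, Matrix.empty_val', Matrix.cons_val_fin_one, map_one, map_neg]
  refine ⟨by ring, by ring, by ring, by ring⟩

/-- **`N_Δ(𝔸)` AT `n = 1` IN ENTRIES**: `h ∈ N_Δ ↔ h₀₀ + h₀₁ = 1 ∧ h₁₀ + h₁₁ = 1 ∧ h₁₁ − h₀₁ = 1` (the triangular frame `E₁ · blk h · E₂ = (1 X; 0 1)` of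
★ `mem_unipDelta_iff_conj`, read on `1 × 1` blocks). [cite: Tan1999, §1] [cite: MoeglinWaldspurger1995, I.2.1] -/
theorem mem_unipDelta_one_iff (h : HA L (Equiv.prodUnique (Fin 1) (Fin 1)) (fun _ => (1 : L)) (fun _ => map_one _) (fun _ => (1 : L)) (fun _ => map_one _)) :
    h ∈ unipDelta L (Equiv.prodUnique (Fin 1) (Fin 1)) (fun _ => (1 : L)) (fun _ => map_one _) (fun _ => (1 : L)) (fun _ => map_one _) ↔
      ((h : GL (Fin (1 + 1)) (AdeleRing (𝓞 L) L)) : Matrix (Fin (1 + 1)) (Fin (1 + 1)) (AdeleRing (𝓞 L) L)) 0 0 +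
            ((h : GL (Fin (1 + 1)) (AdeleRing (𝓞 L) L)) : Matrix (Fin (1 + 1)) (Fin (1 + 1)) (AdeleRing (𝓞 L) L)) 0 1 = 1 ∧
        ((h : GL (Fin (1 + 1)) (AdeleRing (𝓞 L) L)) : Matrix (Fin (1 + 1)) (Fin (1 + 1)) (AdeleRing (𝓞 L) L)) 1 0 +
            ((h : GL (Fin (1 + 1)) (AdeleRing (𝓞 L) L)) : Matrix (Fin (1 + 1)) (Fin (1 + 1)) (AdeleRing (𝓞 L) L)) 1 1 = 1 ∧
        ((h : GL (Fin (1 + 1)) (AdeleRing (𝓞 L) L)) : Matrix (Fin (1 + 1)) (Fin (1 + 1)) (AdeleRing (𝓞 L) L)) 1 1 -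
            ((h : GL (Fin (1 + 1)) (AdeleRing (𝓞 L) L)) : Matrix (Fin (1 + 1)) (Fin (1 + 1)) (AdeleRing (𝓞 L) L)) 0 1 = 1 := by
  obtain ⟨h11, h12, h21, h22⟩ := blk_toBlocks_one L h
  rw [mem_unipDelta_iff_conj]
  conv_lhs => rw [← Matrix.fromBlocks_toBlocks (blk L (Equiv.prodUnique (Fin 1) (Fin 1)) (fun _ => (1 : L)) (fun _ => map_one _)
    (fun _ => (1 : L)) (fun _ => map_one _) h)]
  rw [Matrix.fromBlocks_multiply, Matrix.fromBlocks_multiply, Matrix.toBlocks_fromBlocks₁₂, Matrix.fromBlocks_inj,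
    matrix_fin_one_eq_iff, matrix_fin_one_eq_iff, matrix_fin_one_eq_iff, matrix_fin_one_eq_iff]
  simp only [Matrix.mul_one, Matrix.one_mul, Matrix.mul_zero, Matrix.zero_mul, add_zero, zero_add, Matrix.neg_mul, Matrix.add_apply,
    Matrix.neg_apply, Matrix.one_apply_eq, Matrix.zero_apply, h11, h12, h21, h22]
  constructor
  · rintro ⟨e1, -, e3, e4⟩
    exact ⟨e1, by linear_combination e3 + e1, by linear_combination e4⟩
  · rintro ⟨e1, e2, e3⟩
    exact ⟨e1, trivial, by linear_combination e2 - e1, by linear_combination e3⟩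

/-- **`Ψ_S` CARRIES THE UNIPOTENT RADICAL `N` OF THE BOREL OF `U(Φ)` ONTO `N_Δ`**: `Ψ_S g ∈ N_Δ(𝔸) ↔ g₁₀ = 0 ∧ g₀₀ = 1 ∧ g₁₁ = 1` (so `g = n(x) = (1 x; 0 1)`,
`Ψ_S n(x) = ((1+x, −x), (x, 1−x))` with frame `(1 −x; 0 1)`).  Form-generic: any `Φ` congruent to `hermD` through `S`. [cite: Tan1999, §1] [cite: GelbartRogawski1991, §3.1] -/
theorem congr_mem_unipDelta_iff (S : GL (Fin 2) L) (hS : (S : Matrix (Fin 2) (Fin 2) L) = !![1, 2⁻¹; 1, -2⁻¹])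
    (hS' : ((S⁻¹ : GL (Fin 2) L) : Matrix (Fin 2) (Fin 2) L) = !![2⁻¹, 2⁻¹; 1, -1]) (Φ : Matrix (Fin 2) (Fin 2) L)
    (hΦ : ((S : Matrix (Fin 2) (Fin 2) L).map (cmConjRingHom L))ᵀ *
        hermD L (Equiv.prodUnique (Fin 1) (Fin 1)) (fun _ => (1 : L)) (fun _ => map_one _) (fun _ => (1 : L)) (fun _ => map_one _) *
        (S : Matrix (Fin 2) (Fin 2) L) = Φ)
    (g : adelicUnitaryGroup L Φ) :
    adelicUnitaryGroupCongr L S _ _ hΦ g ∈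
        unipDelta L (Equiv.prodUnique (Fin 1) (Fin 1)) (fun _ => (1 : L)) (fun _ => map_one _) (fun _ => (1 : L)) (fun _ => map_one _) ↔
      ((g : GL (Fin 2) (AdeleRing (𝓞 L) L)) : Matrix (Fin 2) (Fin 2) (AdeleRing (𝓞 L) L)) 1 0 = 0 ∧
        ((g : GL (Fin 2) (AdeleRing (𝓞 L) L)) : Matrix (Fin 2) (Fin 2) (AdeleRing (𝓞 L) L)) 0 0 = 1 ∧
        ((g : GL (Fin 2) (AdeleRing (𝓞 L) L)) : Matrix (Fin 2) (Fin 2) (AdeleRing (𝓞 L) L)) 1 1 = 1 := by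
  have ht : algebraMap L (AdeleRing (𝓞 L) L) 2⁻¹ + algebraMap L (AdeleRing (𝓞 L) L) 2⁻¹ = 1 := by
    rw [← map_add, show (2⁻¹ : L) + 2⁻¹ = 1 by norm_num, map_one]
  have h4 : (4 : AdeleRing (𝓞 L) L) * (algebraMap L (AdeleRing (𝓞 L) L) 2⁻¹ * algebraMap L (AdeleRing (𝓞 L) L) 2⁻¹) = 1 := by
    linear_combination (algebraMap L (AdeleRing (𝓞 L) L) 2⁻¹ + algebraMap L (AdeleRing (𝓞 L) L) 2⁻¹ + 1) * ht
  obtain ⟨e00, e01, e10, e11⟩ := conj_entries L S hS hS' (g : GL (Fin 2) (AdeleRing (𝓞 L) L))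
  refine (mem_unipDelta_one_iff L _).trans ?_
  change ((toAdeleGL L S * (g : GL (Fin 2) (AdeleRing (𝓞 L) L)) * (toAdeleGL L S)⁻¹ : GL (Fin 2) (AdeleRing (𝓞 L) L)) :
          Matrix (Fin 2) (Fin 2) (AdeleRing (𝓞 L) L)) 0 0 +
        ((toAdeleGL L S * (g : GL (Fin 2) (AdeleRing (𝓞 L) L)) * (toAdeleGL L S)⁻¹ : GL (Fin 2) (AdeleRing (𝓞 L) L)) :
          Matrix (Fin 2) (Fin 2) (AdeleRing (𝓞 L) L)) 0 1 = 1 ∧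
      ((toAdeleGL L S * (g : GL (Fin 2) (AdeleRing (𝓞 L) L)) * (toAdeleGL L S)⁻¹ : GL (Fin 2) (AdeleRing (𝓞 L) L)) :
          Matrix (Fin 2) (Fin 2) (AdeleRing (𝓞 L) L)) 1 0 +
        ((toAdeleGL L S * (g : GL (Fin 2) (AdeleRing (𝓞 L) L)) * (toAdeleGL L S)⁻¹ : GL (Fin 2) (AdeleRing (𝓞 L) L)) :
          Matrix (Fin 2) (Fin 2) (AdeleRing (𝓞 L) L)) 1 1 = 1 ∧
      ((toAdeleGL L S * (g : GL (Fin 2) (AdeleRing (𝓞 L) L)) * (toAdeleGL L S)⁻¹ : GL (Fin 2) (AdeleRing (𝓞 L) L)) :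
          Matrix (Fin 2) (Fin 2) (AdeleRing (𝓞 L) L)) 1 1 -
        ((toAdeleGL L S * (g : GL (Fin 2) (AdeleRing (𝓞 L) L)) * (toAdeleGL L S)⁻¹ : GL (Fin 2) (AdeleRing (𝓞 L) L)) :
          Matrix (Fin 2) (Fin 2) (AdeleRing (𝓞 L) L)) 0 1 = 1 ↔ _
  rw [e00, e01, e10, e11]
  constructor
  · rintro ⟨f1, f2, f3⟩
    have hc : ((g : GL (Fin 2) (AdeleRing (𝓞 L) L)) : Matrix (Fin 2) (Fin 2) (AdeleRing (𝓞 L) L)) 1 0 = 0 := by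
      linear_combination f1 - f2 - ((g : GL (Fin 2) (AdeleRing (𝓞 L) L)) : Matrix (Fin 2) (Fin 2) (AdeleRing (𝓞 L) L)) 1 0 * h4
    refine ⟨hc, ?_, ?_⟩
    · linear_combination (algebraMap L (AdeleRing (𝓞 L) L) 2⁻¹) * f1 + (algebraMap L (AdeleRing (𝓞 L) L) 2⁻¹) * f2 - ((g : GL (Fin 2) (AdeleRing (𝓞 L) L)) : Matrix (Fin 2) (Fin 2) (AdeleRing (𝓞 L) L)) 0 0 * h4 + ht
    · linear_combination f3 - ((g : GL (Fin 2) (AdeleRing (𝓞 L) L)) : Matrix (Fin 2) (Fin 2) (AdeleRing (𝓞 L) L)) 1 1 * ht + 2 * (algebraMap L (AdeleRing (𝓞 L) L) 2⁻¹) * (algebraMap L (AdeleRing (𝓞 L) L) 2⁻¹) * hc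
  · rintro ⟨hc, ha, hd⟩
    refine ⟨?_, ?_, ?_⟩
    · linear_combination 2 * (algebraMap L (AdeleRing (𝓞 L) L) 2⁻¹) * ha + 2 * (algebraMap L (AdeleRing (𝓞 L) L) 2⁻¹) * (algebraMap L (AdeleRing (𝓞 L) L) 2⁻¹) * hc + ht
    · linear_combination 2 * (algebraMap L (AdeleRing (𝓞 L) L) 2⁻¹) * ha - 2 * (algebraMap L (AdeleRing (𝓞 L) L) 2⁻¹) * (algebraMap L (AdeleRing (𝓞 L) L) 2⁻¹) * hc + ht
    · linear_combination (-2) * (algebraMap L (AdeleRing (𝓞 L) L) 2⁻¹) * (algebraMap L (AdeleRing (𝓞 L) L) 2⁻¹) * hc + 2 * (algebraMap L (AdeleRing (𝓞 L) L) 2⁻¹) * hd + ht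

/-- **`Ψ_S` CARRIES THE SCALED LONG WEYL ELEMENT TO `w_Δ`**: for `w ∈ U(Φ)(𝔸)` with matrix `(0 ½; 2 0)`, `Ψ_S w = w_Δ = ι(1, −1)` (★ `weylDelta`;
`S_𝔸 w S_𝔸⁻¹ = diag(1, −1) = blk w_Δ`, ★ `blk_weylDelta`, ★ `eq_of_blk_eq`).  The unscaled `w₀ = antidiag(1, 1) = w · diag(½, 2)` is carried to
`w_Δ · Ψ_S(diag(½, 2))`. [cite: Tan1999, §2] [cite: GelbartRogawski1991, §3.1] -/
theorem congr_eq_weylDelta (S : GL (Fin 2) L) (hS : (S : Matrix (Fin 2) (Fin 2) L) = !![1, 2⁻¹; 1, -2⁻¹])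
    (hS' : ((S⁻¹ : GL (Fin 2) L) : Matrix (Fin 2) (Fin 2) L) = !![2⁻¹, 2⁻¹; 1, -1]) (Φ : Matrix (Fin 2) (Fin 2) L)
    (hΦ : ((S : Matrix (Fin 2) (Fin 2) L).map (cmConjRingHom L))ᵀ *
        hermD L (Equiv.prodUnique (Fin 1) (Fin 1)) (fun _ => (1 : L)) (fun _ => map_one _) (fun _ => (1 : L)) (fun _ => map_one _) *
        (S : Matrix (Fin 2) (Fin 2) L) = Φ)
    (w : adelicUnitaryGroup L Φ)
    (hw : ((w : GL (Fin 2) (AdeleRing (𝓞 L) L)) : Matrix (Fin 2) (Fin 2) (AdeleRing (𝓞 L) L)) 0 0 = 0 ∧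
      ((w : GL (Fin 2) (AdeleRing (𝓞 L) L)) : Matrix (Fin 2) (Fin 2) (AdeleRing (𝓞 L) L)) 0 1 = algebraMap L (AdeleRing (𝓞 L) L) 2⁻¹ ∧
      ((w : GL (Fin 2) (AdeleRing (𝓞 L) L)) : Matrix (Fin 2) (Fin 2) (AdeleRing (𝓞 L) L)) 1 0 = algebraMap L (AdeleRing (𝓞 L) L) 2 ∧
      ((w : GL (Fin 2) (AdeleRing (𝓞 L) L)) : Matrix (Fin 2) (Fin 2) (AdeleRing (𝓞 L) L)) 1 1 = 0) :
    adelicUnitaryGroupCongr L S _ _ hΦ w =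
      weylDelta L (Equiv.prodUnique (Fin 1) (Fin 1)) (fun _ => (1 : L)) (fun _ => map_one _) (fun _ => (1 : L)) (fun _ => map_one _) := by
  obtain ⟨w00, w01, w10, w11⟩ := hw
  have ht : algebraMap L (AdeleRing (𝓞 L) L) 2⁻¹ + algebraMap L (AdeleRing (𝓞 L) L) 2⁻¹ = 1 := by
    rw [← map_add, show (2⁻¹ : L) + 2⁻¹ = 1 by norm_num, map_one]
  have h2 : algebraMap L (AdeleRing (𝓞 L) L) 2⁻¹ * algebraMap L (AdeleRing (𝓞 L) L) 2 = 1 := by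
    rw [← map_mul, inv_mul_cancel₀ (two_ne_zero' L), map_one]
  obtain ⟨e00, e01, e10, e11⟩ := conj_entries L S hS hS' (w : GL (Fin 2) (AdeleRing (𝓞 L) L))
  rw [w00, w01, w10, w11] at e00 e01 e10 e11
  obtain ⟨h11, h12, h21, h22⟩ := blk_toBlocks_one L (adelicUnitaryGroupCongr L S _ _ hΦ w)
  refine eq_of_blk_eq L (Equiv.prodUnique (Fin 1) (Fin 1)) (fun _ => (1 : L)) (fun _ => map_one _) (fun _ => (1 : L)) (fun _ => map_one _) ?_
  rw [blk_weylDelta, ← Matrix.fromBlocks_toBlocks (blk L (Equiv.prodUnique (Fin 1) (Fin 1)) (fun _ => (1 : L)) (fun _ => map_one _)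
    (fun _ => (1 : L)) (fun _ => map_one _) (adelicUnitaryGroupCongr L S _ _ hΦ w)), Matrix.fromBlocks_inj,
    matrix_fin_one_eq_iff, matrix_fin_one_eq_iff, matrix_fin_one_eq_iff, matrix_fin_one_eq_iff, h11, h12, h21, h22]
  change ((toAdeleGL L S * (w : GL (Fin 2) (AdeleRing (𝓞 L) L)) * (toAdeleGL L S)⁻¹ : GL (Fin 2) (AdeleRing (𝓞 L) L)) :
          Matrix (Fin 2) (Fin 2) (AdeleRing (𝓞 L) L)) 0 0 = (1 : Matrix (Fin 1) (Fin 1) (AdeleRing (𝓞 L) L)) 0 0 ∧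
      ((toAdeleGL L S * (w : GL (Fin 2) (AdeleRing (𝓞 L) L)) * (toAdeleGL L S)⁻¹ : GL (Fin 2) (AdeleRing (𝓞 L) L)) :
          Matrix (Fin 2) (Fin 2) (AdeleRing (𝓞 L) L)) 0 1 = (0 : Matrix (Fin 1) (Fin 1) (AdeleRing (𝓞 L) L)) 0 0 ∧
      ((toAdeleGL L S * (w : GL (Fin 2) (AdeleRing (𝓞 L) L)) * (toAdeleGL L S)⁻¹ : GL (Fin 2) (AdeleRing (𝓞 L) L)) :
          Matrix (Fin 2) (Fin 2) (AdeleRing (𝓞 L) L)) 1 0 = (0 : Matrix (Fin 1) (Fin 1) (AdeleRing (𝓞 L) L)) 0 0 ∧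
      ((toAdeleGL L S * (w : GL (Fin 2) (AdeleRing (𝓞 L) L)) * (toAdeleGL L S)⁻¹ : GL (Fin 2) (AdeleRing (𝓞 L) L)) :
          Matrix (Fin 2) (Fin 2) (AdeleRing (𝓞 L) L)) 1 1 = (-1 : Matrix (Fin 1) (Fin 1) (AdeleRing (𝓞 L) L)) 0 0
  rw [e00, e01, e10, e11, Matrix.one_apply_eq, Matrix.zero_apply, Matrix.neg_apply, Matrix.one_apply_eq]
  refine ⟨?_, ?_, ?_, ?_⟩
  · linear_combination (algebraMap L (AdeleRing (𝓞 L) L) 2⁻¹) * h2 + ht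
  · linear_combination (algebraMap L (AdeleRing (𝓞 L) L) 2⁻¹) * h2
  · linear_combination (-(algebraMap L (AdeleRing (𝓞 L) L) 2⁻¹)) * h2
  · linear_combination (-(algebraMap L (AdeleRing (𝓞 L) L) 2⁻¹)) * h2 - ht

end Dictionary

/-! ## §2 Transport of integrals along a measurable bijection of subtypes (generic) -/

section Transport

variable {G H : Type*} [MeasurableSpace G] [MeasurableSpace H] {M : Type*} [NormedAddCommGroup M] [NormedSpace ℝ M]

/-- **Change of variables along a measurable bijection carrying `{p}` onto `{q}`**: for `ψ : G → H` measurable with measurable inverse `ψ'` and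
`p x ↔ q (ψ x)`, the restriction `ψ| : {p} ≃ᵐ {q}` is a measurable equivalence, so `∫_{q} F d(ψ|⁎ν) = ∫_{p} F ∘ ψ| dν` for EVERY `F` (Mathlib
`MeasureTheory.integral_map_equiv`; no measurability or integrability of `F` needed). [folklore] -/
theorem integral_map_subtype_equiv {p : G → Prop} {q : H → Prop} (ψ : G → H) (ψ' : H → G) (hψ : Measurable ψ) (hψ' : Measurable ψ')
    (h₁ : Function.LeftInverse ψ' ψ) (h₂ : Function.RightInverse ψ' ψ) (hpq : ∀ x, p x ↔ q (ψ x)) (ν : Measure (Subtype p))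
    (F : Subtype q → M) :
    ∫ u, F u ∂(Measure.map (fun v : Subtype p => (⟨ψ v, (hpq v).1 v.2⟩ : Subtype q)) ν) = ∫ v, F ⟨ψ v, (hpq v).1 v.2⟩ ∂ν := by
  let e : Subtype p ≃ᵐ Subtype q :=
    { toFun := fun v => ⟨ψ v, (hpq v).1 v.2⟩
      invFun := fun u => ⟨ψ' u, (hpq _).2 (by rw [h₂ u]; exact u.2)⟩
      left_inv := fun v => Subtype.ext (h₁ v)
      right_inv := fun u => Subtype.ext (h₂ u)
      measurable_toFun := (hψ.comp measurable_subtype_coe).subtype_mk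
      measurable_invFun := (hψ'.comp measurable_subtype_coe).subtype_mk }
  exact integral_map_equiv e F

end Transport

/-! ## §3 `U(J₂)` in the campaign's tokens: `Ψ_S(N(𝔸)) = N_Δ(𝔸)`, the scaled Weyl element, and `M(w) = M_Δ` -/

section RankOne

variable (L : Type) [Field L] [NumberField L] [IsCMField L]

/-- The congruence witness for the campaign's form: `(c S)ᵀ · hermD · S = (StdForm.antidiagonal 2).over L` (★ `bridge_congr` + ★ `antidiagOne_eq_over`), so that
`Ψ_S = adelicUnitaryGroupCongr L S _ _ (bridge_congr_over L S hS) : U(J₂)(𝔸) = (quasiSplit L⁺ L c 2).Adelic ≃ₜ* H(𝔸)`. [cite: PlatonovRapinchuk1994, §2.3] -/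
theorem bridge_congr_over (S : GL (Fin 2) L) (hS : (S : Matrix (Fin 2) (Fin 2) L) = !![1, 2⁻¹; 1, -2⁻¹]) :
    ((S : Matrix (Fin 2) (Fin 2) L).map (cmConjRingHom L))ᵀ *
        hermD L (Equiv.prodUnique (Fin 1) (Fin 1)) (fun _ => (1 : L)) (fun _ => map_one _) (fun _ => (1 : L)) (fun _ => map_one _) *
        (S : Matrix (Fin 2) (Fin 2) L) = (StdForm.antidiagonal 2).over L := by
  rw [← antidiagOne_eq_over (L := L) (N := 2)]
  exact bridge_congr L S hS

/-- **`N(𝔸_F)` of `U(J₂)` IN ENTRIES**: `v ∈ adelicUnipotent ↔ v₁₀ = 0 ∧ v₀₀ = 1 ∧ v₁₁ = 1` (★ `mem_adelicUnipotent_iff`, ★ `mem_upperUnitriangular_iff`).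
[cite: Rogawski1990, §1.10] -/
theorem mem_adelicUnipotent_two_iff (v : (quasiSplit (↥(maximalRealSubfield L)) L (IsCMField.complexConj L) 2).Adelic) :
    v ∈ adelicUnipotent (↥(maximalRealSubfield L)) L (IsCMField.complexConj L) 2 ↔
      ((v.1 : GL (Fin 2) (AdeleRing (𝓞 L) L)) : Matrix (Fin 2) (Fin 2) (AdeleRing (𝓞 L) L)) 1 0 = 0 ∧ ((v.1 : GL (Fin 2) (AdeleRing (𝓞 L) L)) : Matrix (Fin 2) (Fin 2) (AdeleRing (𝓞 L) L)) 0 0 = 1 ∧ ((v.1 : GL (Fin 2) (AdeleRing (𝓞 L) L)) : Matrix (Fin 2) (Fin 2) (AdeleRing (𝓞 L) L)) 1 1 = 1 := by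
  rw [mem_adelicUnipotent_iff, mem_upperUnitriangular_iff, adelicVal_apply]
  constructor
  · rintro ⟨h1, h2⟩
    exact ⟨h1 (show (id (0 : Fin 2)) < id 1 by decide), h2 0, h2 1⟩
  · rintro ⟨h10, h00, h11⟩
    refine ⟨fun i j hij => ?_, fun i => ?_⟩
    · fin_cases i <;> fin_cases j <;> simp_all
    · fin_cases i
      · exact h00
      · exact h11

/-- **`Ψ_S(N(𝔸)) = N_Δ(𝔸)` FOR `U(J₂)`**: `Ψ_S v ∈ unipDelta ↔ v ∈ adelicUnipotent` — K2E1-p09's `N` (★ `intertwiningU`'s domain of integration) is carried onto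
K2Liu's `N_Δ` (★ `intertwiningDelta`'s). [cite: Tan1999, §1] -/
theorem congr_mem_unipDelta_iff_mem_adelicUnipotent (S : GL (Fin 2) L) (hS : (S : Matrix (Fin 2) (Fin 2) L) = !![1, 2⁻¹; 1, -2⁻¹])
    (hS' : ((S⁻¹ : GL (Fin 2) L) : Matrix (Fin 2) (Fin 2) L) = !![2⁻¹, 2⁻¹; 1, -1]) (v : (quasiSplit (↥(maximalRealSubfield L)) L (IsCMField.complexConj L) 2).Adelic) :
    adelicUnitaryGroupCongr L S _ _ (bridge_congr_over L S hS) v ∈ unipDelta L (Equiv.prodUnique (Fin 1) (Fin 1)) (fun _ => (1 : L)) (fun _ => map_one _) (fun _ => (1 : L)) (fun _ => map_one _) ↔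
      v ∈ adelicUnipotent (↥(maximalRealSubfield L)) L (IsCMField.complexConj L) 2 := by
  rw [mem_adelicUnipotent_two_iff]
  exact congr_mem_unipDelta_iff L S hS hS' _ (bridge_congr_over L S hS) v

/-- **THE SCALED LONG WEYL ELEMENT OF `U(J₂)(L⁺)`**: `w = (0 ½; 2 0) ∈ U(J₂)(L)` (unitary: `(c w)ᵀ J₂ w = J₂`; `w² = 1`; `w = w₀ · diag(2, ½)` with `w₀ = antidiag(1,1)`
the campaign's `weylLongU`), with adelic matrix `(0 ½_𝔸; 2_𝔸 0)` — the element that `Ψ_S` carries EXACTLY to K2Liu's `w_Δ` (`congr_eq_weylDelta`). [cite: Tan1999, §2] -/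
theorem exists_scaledWeyl_two :
    ∃ γ : ↥(unitaryGroupOfForm ((IsCMField.complexConj L : L ≃ₐ[↥(maximalRealSubfield L)] L) : L →+* L) ((StdForm.antidiagonal 2).over L)),
      ((γ : GL (Fin 2) L) : Matrix (Fin 2) (Fin 2) L) = !![0, 2⁻¹; 2, 0] ∧
      (((((quasiSplit (↥(maximalRealSubfield L)) L (IsCMField.complexConj L) 2).toAdelic γ).1 : GL (Fin 2) (AdeleRing (𝓞 L) L)) : Matrix (Fin 2) (Fin 2) (AdeleRing (𝓞 L) L))) 0 0 = 0 ∧ (((((quasiSplit (↥(maximalRealSubfield L)) L (IsCMField.complexConj L) 2).toAdelic γ).1 : GL (Fin 2) (AdeleRing (𝓞 L) L)) : Matrix (Fin 2) (Fin 2) (AdeleRing (𝓞 L) L))) 0 1 = algebraMap L (AdeleRing (𝓞 L) L) 2⁻¹ ∧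
      (((((quasiSplit (↥(maximalRealSubfield L)) L (IsCMField.complexConj L) 2).toAdelic γ).1 : GL (Fin 2) (AdeleRing (𝓞 L) L)) : Matrix (Fin 2) (Fin 2) (AdeleRing (𝓞 L) L))) 1 0 = algebraMap L (AdeleRing (𝓞 L) L) 2 ∧ (((((quasiSplit (↥(maximalRealSubfield L)) L (IsCMField.complexConj L) 2).toAdelic γ).1 : GL (Fin 2) (AdeleRing (𝓞 L) L)) : Matrix (Fin 2) (Fin 2) (AdeleRing (𝓞 L) L))) 1 1 = 0 := by
  have hsq : !![(0 : L), 2⁻¹; 2, 0] * !![(0 : L), 2⁻¹; 2, 0] = 1 := by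
    ext i j
    fin_cases i <;> fin_cases j <;> simp [Matrix.mul_apply, Fin.sum_univ_two]
  have hmem : (⟨!![(0 : L), 2⁻¹; 2, 0], !![(0 : L), 2⁻¹; 2, 0], hsq, hsq⟩ : GL (Fin 2) L) ∈
      unitaryGroupOfForm ((IsCMField.complexConj L : L ≃ₐ[↥(maximalRealSubfield L)] L) : L →+* L) ((StdForm.antidiagonal 2).over L) := by
    rw [mem_unitaryGroupOfForm_iff, ← antidiagOne_eq_over (L := L) (N := 2)]
    ext i j
    fin_cases i <;> fin_cases j <;>
      simp [Matrix.mul_apply, Fin.sum_univ_two, Matrix.map_apply, Matrix.of_apply, map_ofNat, map_inv₀]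
  refine ⟨⟨_, hmem⟩, rfl, ?_, ?_, ?_, ?_⟩
  · exact map_zero (algebraMap L (AdeleRing (𝓞 L) L))
  · rfl
  · rfl
  · exact map_zero (algebraMap L (AdeleRing (𝓞 L) L))

set_option maxHeartbeats 400000 in
/-- **`M(w)` ON `U(J₂)` IS K2Liu's `M_Δ` AT `n = 1`.**  For an inversion-invariant measure `ν` on `N(𝔸_F) = adelicUnipotent` (every Haar measure of this
commutative group is), ANY `f : H(𝔸) → ℂ`, the scaled Weyl element `w` (`w_𝔸 = (0 ½; 2 0)`, `exists_scaledWeyl_two`) and every `x ∈ U(J₂)(𝔸)`: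
`intertwiningU N(𝔸) ν w (g ↦ f (Ψ_S g⁻¹)) x = intertwiningDelta ((Ψ_S|_N)⁎ν) f (Ψ_S x⁻¹)`, i.e. `∫_N f(Ψ_S((x v w⁻¹)⁻¹)) dν(v) = ∫_{N_Δ} f(w_Δ u Ψ_S(x⁻¹)) d(Ψ_S|_N)⁎ν(u)` —
K2E1-p09's RIGHT-convention operator (★ p857354, `φ = f ∘ Ψ_S ∘ inv`) is K2Liu's LEFT-convention Siegel intertwining integral (★ D9) at the transported point,
against the transported measure (`Ψ_S|_N : N(𝔸) ≅ N_Δ(𝔸)` is a topological isomorphism, so `(Ψ_S|_N)⁎ν` is a Haar measure on `N_Δ(𝔸)`; its normalisation against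
K2Liu's choice is not fixed here).  Proof: `(x v w⁻¹)⁻¹ = w v⁻¹ x⁻¹`, `Ψ_S w = w_Δ` (`congr_eq_weylDelta`), `v ↦ v⁻¹` preserves `ν`, change of variables (§2).
[cite: MoeglinWaldspurger1995, II.1.6] [cite: Tan1999, §2] -/
theorem intertwiningU_eq_intertwiningDelta
    [MeasurableSpace (quasiSplit (↥(maximalRealSubfield L)) L (IsCMField.complexConj L) 2).Adelic] [BorelSpace (quasiSplit (↥(maximalRealSubfield L)) L (IsCMField.complexConj L) 2).Adelic] [MeasurableSpace (HA L (Equiv.prodUnique (Fin 1) (Fin 1)) (fun _ => (1 : L)) (fun _ => map_one _) (fun _ => (1 : L)) (fun _ => map_one _))] [BorelSpace (HA L (Equiv.prodUnique (Fin 1) (Fin 1)) (fun _ => (1 : L)) (fun _ => map_one _) (fun _ => (1 : L)) (fun _ => map_one _))]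
    (S : GL (Fin 2) L) (hS : (S : Matrix (Fin 2) (Fin 2) L) = !![1, 2⁻¹; 1, -2⁻¹])
    (hS' : ((S⁻¹ : GL (Fin 2) L) : Matrix (Fin 2) (Fin 2) L) = !![2⁻¹, 2⁻¹; 1, -1])
    (ν : Measure ↥(adelicUnipotent (↥(maximalRealSubfield L)) L (IsCMField.complexConj L) 2)) [ν.IsInvInvariant] (f : (HA L (Equiv.prodUnique (Fin 1) (Fin 1)) (fun _ => (1 : L)) (fun _ => map_one _) (fun _ => (1 : L)) (fun _ => map_one _)) → ℂ) (w x : (quasiSplit (↥(maximalRealSubfield L)) L (IsCMField.complexConj L) 2).Adelic)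
    (hw : ((w.1 : GL (Fin 2) (AdeleRing (𝓞 L) L)) : Matrix (Fin 2) (Fin 2) (AdeleRing (𝓞 L) L)) 0 0 = 0 ∧ ((w.1 : GL (Fin 2) (AdeleRing (𝓞 L) L)) : Matrix (Fin 2) (Fin 2) (AdeleRing (𝓞 L) L)) 0 1 = algebraMap L (AdeleRing (𝓞 L) L) 2⁻¹ ∧ ((w.1 : GL (Fin 2) (AdeleRing (𝓞 L) L)) : Matrix (Fin 2) (Fin 2) (AdeleRing (𝓞 L) L)) 1 0 = algebraMap L (AdeleRing (𝓞 L) L) 2 ∧ ((w.1 : GL (Fin 2) (AdeleRing (𝓞 L) L)) : Matrix (Fin 2) (Fin 2) (AdeleRing (𝓞 L) L)) 1 1 = 0) :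
    intertwiningU (adelicUnipotent (↥(maximalRealSubfield L)) L (IsCMField.complexConj L) 2) ν w (fun g => f (adelicUnitaryGroupCongr L S _ _ (bridge_congr_over L S hS) (g⁻¹ : (quasiSplit (↥(maximalRealSubfield L)) L (IsCMField.complexConj L) 2).Adelic))) x =
      intertwiningDelta L (Equiv.prodUnique (Fin 1) (Fin 1)) (fun _ => (1 : L)) (fun _ => map_one _) (fun _ => (1 : L)) (fun _ => map_one _)
        (Measure.map (fun v : ↥(adelicUnipotent (↥(maximalRealSubfield L)) L (IsCMField.complexConj L) 2) => (⟨adelicUnitaryGroupCongr L S _ _ (bridge_congr_over L S hS) (v : (quasiSplit (↥(maximalRealSubfield L)) L (IsCMField.complexConj L) 2).Adelic), (congr_mem_unipDelta_iff_mem_adelicUnipotent L S hS hS' v.1).2 v.2⟩ : ↥(unipDelta L (Equiv.prodUnique (Fin 1) (Fin 1)) (fun _ => (1 : L)) (fun _ => map_one _) (fun _ => (1 : L)) (fun _ => map_one _)))) ν)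
        f (adelicUnitaryGroupCongr L S _ _ (bridge_congr_over L S hS) (x⁻¹ : (quasiSplit (↥(maximalRealSubfield L)) L (IsCMField.complexConj L) 2).Adelic)) := by
  have hW := congr_eq_weylDelta L S hS hS' _ (bridge_congr_over L S hS) w hw
  have hc : @Continuous (quasiSplit (↥(maximalRealSubfield L)) L (IsCMField.complexConj L) 2).Adelic (HA L (Equiv.prodUnique (Fin 1) (Fin 1)) (fun _ => (1 : L)) (fun _ => map_one _) (fun _ => (1 : L)) (fun _ => map_one _)) _ _ (fun g => adelicUnitaryGroupCongr L S _ _ (bridge_congr_over L S hS) g) := (adelicUnitaryGroupCongr L S _ _ (bridge_congr_over L S hS)).continuous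
  have hc' : @Continuous (HA L (Equiv.prodUnique (Fin 1) (Fin 1)) (fun _ => (1 : L)) (fun _ => map_one _) (fun _ => (1 : L)) (fun _ => map_one _)) (quasiSplit (↥(maximalRealSubfield L)) L (IsCMField.complexConj L) 2).Adelic _ _ (fun h => (adelicUnitaryGroupCongr L S _ _ (bridge_congr_over L S hS)).symm h) := (adelicUnitaryGroupCongr L S _ _ (bridge_congr_over L S hS)).symm.continuous
  rw [intertwiningU_apply]
  unfold intertwiningDelta
  rw [integral_map_subtype_equiv (M := ℂ) (p := fun g : (quasiSplit (↥(maximalRealSubfield L)) L (IsCMField.complexConj L) 2).Adelic => g ∈ (adelicUnipotent (↥(maximalRealSubfield L)) L (IsCMField.complexConj L) 2)) (q := fun h : (HA L (Equiv.prodUnique (Fin 1) (Fin 1)) (fun _ => (1 : L)) (fun _ => map_one _) (fun _ => (1 : L)) (fun _ => map_one _)) => h ∈ unipDelta L (Equiv.prodUnique (Fin 1) (Fin 1)) (fun _ => (1 : L)) (fun _ => map_one _) (fun _ => (1 : L)) (fun _ => map_one _))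
    (fun g => adelicUnitaryGroupCongr L S _ _ (bridge_congr_over L S hS) g) (fun h => (adelicUnitaryGroupCongr L S _ _ (bridge_congr_over L S hS)).symm h) hc.measurable hc'.measurable
    (fun g => (adelicUnitaryGroupCongr L S _ _ (bridge_congr_over L S hS)).symm_apply_apply g) (fun h => (adelicUnitaryGroupCongr L S _ _ (bridge_congr_over L S hS)).apply_symm_apply h)
    (fun v => (congr_mem_unipDelta_iff_mem_adelicUnipotent L S hS hS' v).symm) ν]
  conv_rhs => rw [← integral_inv_eq_self]
  congr 1
  funext v
  have h1 : (x * (v : (quasiSplit (↥(maximalRealSubfield L)) L (IsCMField.complexConj L) 2).Adelic) * w⁻¹)⁻¹ = w * ((v⁻¹ : ↥(adelicUnipotent (↥(maximalRealSubfield L)) L (IsCMField.complexConj L) 2)) : (quasiSplit (↥(maximalRealSubfield L)) L (IsCMField.complexConj L) 2).Adelic) * x⁻¹ := by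
    rw [mul_inv_rev, mul_inv_rev, inv_inv, mul_assoc, Subgroup.coe_inv]
  have h2 : adelicUnitaryGroupCongr L S _ _ (bridge_congr_over L S hS) (w * ((v⁻¹ : ↥(adelicUnipotent (↥(maximalRealSubfield L)) L (IsCMField.complexConj L) 2)) : (quasiSplit (↥(maximalRealSubfield L)) L (IsCMField.complexConj L) 2).Adelic) * x⁻¹) =
      adelicUnitaryGroupCongr L S _ _ (bridge_congr_over L S hS) w * adelicUnitaryGroupCongr L S _ _ (bridge_congr_over L S hS) ((v⁻¹ : ↥(adelicUnipotent (↥(maximalRealSubfield L)) L (IsCMField.complexConj L) 2)) : (quasiSplit (↥(maximalRealSubfield L)) L (IsCMField.complexConj L) 2).Adelic) * adelicUnitaryGroupCongr L S _ _ (bridge_congr_over L S hS) (x⁻¹ : (quasiSplit (↥(maximalRealSubfield L)) L (IsCMField.complexConj L) 2).Adelic) :=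
    (map_mul _ _ _).trans (congrArg (· * adelicUnitaryGroupCongr L S _ _ (bridge_congr_over L S hS) (x⁻¹ : (quasiSplit (↥(maximalRealSubfield L)) L (IsCMField.complexConj L) 2).Adelic)) (map_mul _ _ _))
  rw [h1]
  -- no `rw`∕`congr` across the two packagings `↥(adelicUnitaryGroup L hermD)` ∕ `H(𝔸)` of the same subgroup (keyed matching unfolds matrix products):
  -- assemble the identity by `congrArg` ∕ `Eq.trans` in small named steps (one cross-packaging membership check each)
  have H3 := congrArg (fun y => y * adelicUnitaryGroupCongr L S _ _ (bridge_congr_over L S hS) ((v⁻¹ : ↥(adelicUnipotent (↥(maximalRealSubfield L)) L (IsCMField.complexConj L) 2)) : (quasiSplit (↥(maximalRealSubfield L)) L (IsCMField.complexConj L) 2).Adelic) * adelicUnitaryGroupCongr L S _ _ (bridge_congr_over L S hS) (x⁻¹ : (quasiSplit (↥(maximalRealSubfield L)) L (IsCMField.complexConj L) 2).Adelic)) hW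
  have H4 := h2.trans H3
  refine (congrArg f H4).trans ?_
  rfl

end RankOne

end Summit.HodgeConjecture.HodgeConjecture.Cruxes.H413.K2E1BorelIntertwiningU2FromK2Liu

end
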